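import Summits.HodgeConjecture.CorCM.Census.CentralSquaresOrbitClosure
import Summits.HodgeConjecture.CorCM.Census.CentralSquaresOrderFourClosure

/-!
# The square-central class, XXXVII: THE ORBIT FRAME LAW at `m = 4` — consecutive sums from one designated face per orbit, residual closure up to `4`

COR-CM (cell `pub-hodgecm2`), count-neutral kernel combinatorics by the binder seat b09 (gen 47; lane SQUARE-CENTRAL CLASS, part XXXVII), assembling
parts XXXIV (orbit corner dichotomy), XXXV (`orbit_face_relation_of_dirs`, `thetaG_sub_thetaG_orbit_type`), XXXVI (`four_smul_Y_mem_of_cycle`,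
`four_smul_Y'_mem_of_cycle`), XXV (`rel_transversal_mem'`, `relc_mem'`), VII (the companion frame `(T₀; T̄₁, cQ')`) and XXIV
(`residual_closure_four_pow`) BY NAME.  Theorems only: no definition, no `decide`, no certificate, no named fact, no `sorry`.  HONEST FRAMING:
`HC_CM` is NOT proved, here or anywhere in the tree; nothing here is a period or a headline.

* §1 **`orbit_consecutive_sums`**: in the base-involutive frame `(T₀; T₁, Q)` with a strict lowering cover behind `L ∋ R(T)`, ONE designated face at
  the orbit type `{T ∣ A}` (`A = {a₀, a₁, a₂, a₃}` a `4`-cycle of the place permutation inside `T₀ ∩ T₁`, `m ≥ 4`) puts ALL FOUR consecutive sums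
  `Y'_{a_i} + Y'_{a_{i+1}}` into `L` (the `⟨Q⟩`-translates of the face are the faces at `(a₃,a₀)`, `(a₂,a₃)`, `(a₁,a₂)`; the corner directions are
  transported; part XXXVʼs directional relation is applied four times in each of the four direction cases).
* §2 **`orbit_consecutive_sums_companion`**: the same in the companion frame `(T₀; T̄₁, cQ')` of a second base-involutive swap `Q'` — a designated face
  at a companion orbit type `{A' ∣ B}` (`A' ⊆ T₀ ∩ T₁` a transversal, `B ⊆ 𝓗` a `4`-cycle of the place permutation of `Q'`) gives the four consecutive
  sums `Y_{b_i} + Y_{b_{i+1}}` (pairs absorbed).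
* §3 **`residual_closure_orbit_four`**: if every place of `T₀ ∩ T₁` lies on such a `4`-cycle of `Q` with its consecutive `Y'`-sums in `L`, and every place
  of `𝓗` on a `4`-cycle of `Q'` with its consecutive `Y`-sums in `L`, then `4y ∈ L` for every residual Hodge vector `y` (parts XXXVI + XXV + XXIV).
The kernel-four rows (`π : G ↠ D₄`, `|ker π| = 4`, a reflection lift `q` of order `4`; part XXXVIII) are the instance `Q = q`, `Q' = c·g₁qg₁⁻¹`.

## References
* [Pohlmann1968] H. Pohlmann, Algebraic cycles on abelian varieties of complex multiplication type, Ann. of Math. 88 (1968), Thm 1.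
* [Milne1999] J. S. Milne, Lefschetz motives and the Tate conjecture, Compositio Math. 117 (1999), Prop. 2.1, p. 54.
-/

namespace Summit.HodgeConjecture.CorCM.Census.CentralSquares

open Finset
open scoped symmDiff
open Summit.HodgeConjecture.CorCM.Prior.AllgGroup.RfwfAllgGroup
open Summit.HodgeConjecture.CorCM.Census.BlockParity
open Summit.HodgeConjecture.CorCM.Census.Coinvariant
open Summit.HodgeConjecture.CorCM.Census.TwistGeneration
open Summit.HodgeConjecture.CorCM.Census.BaseBlock
open Summit.HodgeConjecture.CorCM.Census.CoverClosure

noncomputable section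

variable {G : Type*} [Group G] [Fintype G] [DecidableEq G] (c : G)

section Frame

variable (hc2 : c * c = 1) (hcen : ∀ x : G, x * c = c * x) (T₀ T₁ : CMF G c)
variable (hbase : ∀ Q : G, rt c Q T₀ = T₀ ∨ rt c Q T₀ = rt c c T₀ ∨ rt c Q T₀ = T₁ ∨ rt c Q T₀ = rt c c T₁)
variable (m : ℕ) (hn : T₀.1.card = 4 * m) (hH : (T₀.1 \ T₁.1).card = 2 * m)
variable (Q : G) (hQ : rt c Q T₀ = T₁) (hQ₁ : rt c Q T₁ = T₀)
variable (hσH : ∀ t ∈ T₀.1, ∀ t' ∈ T₀.1, (t' = t * Q ∨ t' = c * (t * Q)) → (t ∈ T₀.1 \ T₁.1 ↔ t' ∈ T₀.1 \ T₁.1))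
variable (L : Submodule ℤ (CMF G c →₀ ℤ)) (hLrt : ∀ (Q' : G) (y : CMF G c →₀ ℤ), y ∈ L → Finsupp.mapDomain (rt c Q') y ∈ L)
variable (hcover : ∀ Ψ : CMF G c, 2 ≤ bpot c T₀ Ψ → ∃ Q₂ s s' : G, bpot c T₀ Ψ = ddist (rt c Q₂ T₀) Ψ ∧
    s ∈ (rt c Q₂ T₀).1 \ Ψ.1 ∧ s' ∈ (rt c Q₂ T₀).1 \ Ψ.1 ∧ s ≠ s' ∧
    gface c hc2 Ψ s s' ∈ L ∧
    ((∃ Q₁ t t' : G, bpot c T₀ Ψ = ddist (rt c Q₁ T₀) Ψ ∧ t ∈ (rt c Q₁ T₀).1 \ Ψ.1 ∧ t' ∈ (rt c Q₁ T₀).1 \ Ψ.1 ∧ t ≠ t' ∧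
        (∀ Q' : G, ddist (rt c Q' T₀) (oflipCM c hc2 t Ψ) = bpot c T₀ (oflipCM c hc2 t Ψ) → rt c Q' T₀ = rt c Q₁ T₀) ∧
        (∀ Q' : G, ddist (rt c Q' T₀) (oflipCM c hc2 t' Ψ) = bpot c T₀ (oflipCM c hc2 t' Ψ) → rt c Q' T₀ = rt c Q₁ T₀) ∧
        (∀ Q' : G, ddist (rt c Q' T₀) (oflipCM c hc2 t (oflipCM c hc2 t' Ψ)) = bpot c T₀ (oflipCM c hc2 t (oflipCM c hc2 t' Ψ)) →
          rt c Q' T₀ = rt c Q₁ T₀)) →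
      (∀ Q' : G, ddist (rt c Q' T₀) (oflipCM c hc2 s Ψ) = bpot c T₀ (oflipCM c hc2 s Ψ) → rt c Q' T₀ = rt c Q₂ T₀) ∧
      (∀ Q' : G, ddist (rt c Q' T₀) (oflipCM c hc2 s' Ψ) = bpot c T₀ (oflipCM c hc2 s' Ψ) → rt c Q' T₀ = rt c Q₂ T₀) ∧
      (∀ Q' : G, ddist (rt c Q' T₀) (oflipCM c hc2 s (oflipCM c hc2 s' Ψ)) = bpot c T₀ (oflipCM c hc2 s (oflipCM c hc2 s' Ψ)) →
        rt c Q' T₀ = rt c Q₂ T₀)))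


/-! ## §1 All four consecutive sums on a `σ`-orbit of `T₀ ∩ T₁` from ONE designated face -/

include hcen hbase hn hH hQ hQ₁ hσH hLrt hcover in
/-- **CONSECUTIVE SUMS ON AN ORBIT.**  Base-involutive frame with a strict lowering cover behind the base-change stable lattice `L ∋ R(T)`;
`T ⊆ 𝓗` a transversal of the swap (`|T| = m ≥ 4`), `A = {a₀, a₁, a₂, a₃} ⊆ T₀ ∖ 𝓗` a `4`-cycle of its place permutation
(`a₀ → a₁ → a₂ → a₃ → a₀` on representatives, pairwise distinct), `Φ = {T ∣ A}`.  If the designated face of `Φ` at the places `a₀, a₁` lies in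
`L`, then ALL FOUR consecutive sums `Y'_{a_i} + Y'_{a_{i+1}}` lie in `L`: the three `⟨Q⟩`-translates of the face are the faces at `(a₃,a₀)`,
`(a₂,a₃)`, `(a₁,a₂)`, the directions of their corners are the transported ones, and part XXXVʼs directional relation yields in either direction case
the four relations `R(T) + Y'(A) − Y'_x − Y'_y` over four different consecutive pairs `{x, y}`. [folklore] -/
theorem orbit_consecutive_sums (hm : 4 ≤ m) (T A : Finset G) (hTH : T ⊆ T₀.1 \ T₁.1) (hTm : T.card = m)
    (hT : ∀ t ∈ T₀.1 \ T₁.1, ∀ t' ∈ T₀.1, (t' = t * Q ∨ t' = c * (t * Q)) → (t ∈ T ↔ t' ∉ T))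
    (hA : A ⊆ T₀.1 \ (T₀.1 \ T₁.1))
    (hAσ : ∀ t ∈ T₀.1 \ (T₀.1 \ T₁.1), ∀ t' ∈ T₀.1, (t' = t * Q ∨ t' = c * (t * Q)) → (t ∈ A ↔ t' ∈ A))
    (Φ : CMF G c) (hΦ : T₀.1 \ Φ.1 = T ∪ A) {a₀ a₁ a₂ a₃ : G} (ha₀ : a₀ ∈ A) (ha₁ : a₁ ∈ A) (ha₂ : a₂ ∈ A) (ha₃ : a₃ ∈ A)
    (r₀ : a₁ = a₀ * Q ∨ a₁ = c * (a₀ * Q)) (r₁ : a₂ = a₁ * Q ∨ a₂ = c * (a₁ * Q)) (r₂ : a₃ = a₂ * Q ∨ a₃ = c * (a₂ * Q))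
    (r₃ : a₀ = a₃ * Q ∨ a₀ = c * (a₃ * Q)) (h01 : a₀ ≠ a₁) (h12 : a₁ ≠ a₂) (h23 : a₂ ≠ a₃) (h30 : a₃ ≠ a₀) (h02 : a₀ ≠ a₂) (h13 : a₁ ≠ a₃)
    (hA4 : A = {a₀, a₁, a₂, a₃}) (hF : gface c hc2 Φ a₀ a₁ ∈ L)
    (hR : (∑ s ∈ T, Finsupp.single (oflipCM c hc2 s T₀) (1 : ℤ) - ∑ u ∈ (T₀.1 \ T₁.1) \ T, Finsupp.single (oflipCM c hc2 u T₁) (1 : ℤ) -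
        ((m : ℤ) - 1) • (Finsupp.single T₀ (1 : ℤ) - Finsupp.single T₁ 1)) ∈ L) :
    ((Finsupp.single (oflipCM c hc2 a₀ T₀) (1 : ℤ) - Finsupp.single T₀ 1) - (Finsupp.single (oflipCM c hc2 a₀ T₁) (1 : ℤ) - Finsupp.single T₁ 1)) + ((Finsupp.single (oflipCM c hc2 a₁ T₀) (1 : ℤ) - Finsupp.single T₀ 1) - (Finsupp.single (oflipCM c hc2 a₁ T₁) (1 : ℤ) - Finsupp.single T₁ 1)) ∈ L ∧
    ((Finsupp.single (oflipCM c hc2 a₁ T₀) (1 : ℤ) - Finsupp.single T₀ 1) - (Finsupp.single (oflipCM c hc2 a₁ T₁) (1 : ℤ) - Finsupp.single T₁ 1)) + ((Finsupp.single (oflipCM c hc2 a₂ T₀) (1 : ℤ) - Finsupp.single T₀ 1) - (Finsupp.single (oflipCM c hc2 a₂ T₁) (1 : ℤ) - Finsupp.single T₁ 1)) ∈ L ∧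
    ((Finsupp.single (oflipCM c hc2 a₂ T₀) (1 : ℤ) - Finsupp.single T₀ 1) - (Finsupp.single (oflipCM c hc2 a₂ T₁) (1 : ℤ) - Finsupp.single T₁ 1)) + ((Finsupp.single (oflipCM c hc2 a₃ T₀) (1 : ℤ) - Finsupp.single T₀ 1) - (Finsupp.single (oflipCM c hc2 a₃ T₁) (1 : ℤ) - Finsupp.single T₁ 1)) ∈ L ∧
    ((Finsupp.single (oflipCM c hc2 a₃ T₀) (1 : ℤ) - Finsupp.single T₀ 1) - (Finsupp.single (oflipCM c hc2 a₃ T₁) (1 : ℤ) - Finsupp.single T₁ 1)) + ((Finsupp.single (oflipCM c hc2 a₀ T₀) (1 : ℤ) - Finsupp.single T₀ 1) - (Finsupp.single (oflipCM c hc2 a₀ T₁) (1 : ℤ) - Finsupp.single T₁ 1)) ∈ L := by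
  have hT₀₁ : T₀ ≠ T₁ := by
    intro h; rw [h, Finset.sdiff_self, Finset.card_empty] at hH; omega
  -- memberships
  have hAT₀ : ∀ x ∈ A, x ∈ T₀.1 := fun x hx => (mem_sdiff.mp (hA hx)).1
  have hAD : ∀ x ∈ A, x ∈ T₀.1 \ Φ.1 := fun x hx => by rw [hΦ]; exact mem_union_right _ hx
  have hAΦ : ∀ x ∈ A, x ∉ Φ.1 := fun x hx => (mem_sdiff.mp (hAD x hx)).2
  have hTA : Disjoint T A := by
    rw [disjoint_iff_ne]; rintro x hx y hy rfl; exact (mem_sdiff.mp (hA hy)).2 (hTH hx)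
  have hnotT : ∀ x ∈ A, x ∉ T := fun x hx h => (disjoint_left.mp hTA h) hx
  -- `Q`-stability of `Φ`
  have hstab : rt c Q Φ = Φ :=
    rt_eq_self_of_transversal c T₀ Q (T₀.1 \ T₁.1) (by rw [hQ]) hσH Φ T A hΦ hTH hA hT hAσ
  -- the flipped places under the swap: `a_i·Q⁻¹` flips the place of `a_{i-1}`
  have hq₀ : ∀ Ψ : CMF G c, oflipCM c hc2 (a₀ * Q⁻¹) Ψ = oflipCM c hc2 a₃ Ψ := by
    intro Ψ; rcases r₃ with h | h
    · rw [h, mul_inv_cancel_right]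
    · rw [h, mul_assoc, mul_inv_cancel_right, oflipCM_cmul]
  have hq₁ : ∀ Ψ : CMF G c, oflipCM c hc2 (a₁ * Q⁻¹) Ψ = oflipCM c hc2 a₀ Ψ := by
    intro Ψ; rcases r₀ with h | h
    · rw [h, mul_inv_cancel_right]
    · rw [h, mul_assoc, mul_inv_cancel_right, oflipCM_cmul]
  have hq₂ : ∀ Ψ : CMF G c, oflipCM c hc2 (a₂ * Q⁻¹) Ψ = oflipCM c hc2 a₁ Ψ := by
    intro Ψ; rcases r₁ with h | h
    · rw [h, mul_inv_cancel_right]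
    · rw [h, mul_assoc, mul_inv_cancel_right, oflipCM_cmul]
  have hq₃ : ∀ Ψ : CMF G c, oflipCM c hc2 (a₃ * Q⁻¹) Ψ = oflipCM c hc2 a₂ Ψ := by
    intro Ψ; rcases r₂ with h | h
    · rw [h, mul_inv_cancel_right]
    · rw [h, mul_assoc, mul_inv_cancel_right, oflipCM_cmul]
  -- the three translated faces
  have hF₃ : gface c hc2 Φ a₃ a₀ ∈ L := by
    have h := hLrt Q _ hF
    rw [mapDomain_rt_gface, hstab] at h
    unfold gface at h ⊢; simpa only [hq₀, hq₁] using h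
  have hF₂ : gface c hc2 Φ a₂ a₃ ∈ L := by
    have h := hLrt Q _ hF₃
    rw [mapDomain_rt_gface, hstab] at h
    unfold gface at h ⊢; simpa only [hq₃, hq₀] using h
  have hF₁ : gface c hc2 Φ a₁ a₂ ∈ L := by
    have h := hLrt Q _ hF₂
    rw [mapDomain_rt_gface, hstab] at h
    unfold gface at h ⊢; simpa only [hq₂, hq₃] using h
  -- the translated corners
  have c2_3 : rt c Q (oflipCM c hc2 a₀ (oflipCM c hc2 a₁ Φ)) = oflipCM c hc2 a₃ (oflipCM c hc2 a₀ Φ) := by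
    rw [rt_oflipCM, rt_oflipCM, hstab, hq₀, hq₁]
  have c2_2 : rt c Q (oflipCM c hc2 a₃ (oflipCM c hc2 a₀ Φ)) = oflipCM c hc2 a₂ (oflipCM c hc2 a₃ Φ) := by
    rw [rt_oflipCM, rt_oflipCM, hstab, hq₃, hq₀]
  have c2_1 : rt c Q (oflipCM c hc2 a₂ (oflipCM c hc2 a₃ Φ)) = oflipCM c hc2 a₁ (oflipCM c hc2 a₂ Φ) := by
    rw [rt_oflipCM, rt_oflipCM, hstab, hq₂, hq₃]
  have c1_3 : rt c Q (oflipCM c hc2 a₀ Φ) = oflipCM c hc2 a₃ Φ := by rw [rt_oflipCM, hstab, hq₀]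
  have c1_2 : rt c Q (oflipCM c hc2 a₃ Φ) = oflipCM c hc2 a₂ Φ := by rw [rt_oflipCM, hstab, hq₃]
  have c1_1 : rt c Q (oflipCM c hc2 a₂ Φ) = oflipCM c hc2 a₁ Φ := by rw [rt_oflipCM, hstab, hq₂]
  -- transport of star defects along base changes
  have transport : ∀ (R : G) (B X : CMF G c), Finsupp.single X 1 - thetaG c hc2 B (typeSum G c (Finsupp.single X 1)) ∈ L →
      Finsupp.single (rt c R X) 1 - thetaG c hc2 (rt c R B) (typeSum G c (Finsupp.single (rt c R X) 1)) ∈ L := by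
    intro R B X h
    have h' := hLrt R _ h
    rwa [Finsupp.mapDomain_sub, Finsupp.mapDomain_single, mapDomain_rt_thetaG] at h'
  -- the two dichotomies (part XXXIV) at `Φ^{(a₀)}` and `Φ^{(a₀a₁)}`
  have ha₀D' : a₀ ∈ T₀.1 \ (oflipCM c hc2 a₁ Φ).1 := by
    rw [dev_oflip c hc2 (hAT₀ a₁ ha₁) (hAΦ a₁ ha₁)]; exact mem_erase.mpr ⟨h01, hAD a₀ ha₀⟩
  have hD₁ : T₀.1 \ (oflipCM c hc2 a₀ Φ).1 = T ∪ A.erase a₀ := by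
    rw [dev_oflip c hc2 (hAT₀ a₀ ha₀) (hAΦ a₀ ha₀), hΦ, erase_union_distrib, erase_eq_of_notMem (hnotT a₀ ha₀)]
  have hD₂ : T₀.1 \ (oflipCM c hc2 a₀ (oflipCM c hc2 a₁ Φ)).1 = T ∪ (A.erase a₁).erase a₀ := by
    rw [dev_oflip c hc2 (mem_sdiff.mp ha₀D').1 (mem_sdiff.mp ha₀D').2, dev_oflip c hc2 (hAT₀ a₁ ha₁) (hAΦ a₁ ha₁), hΦ,
      erase_union_distrib, erase_eq_of_notMem (hnotT a₁ ha₁), erase_union_distrib, erase_eq_of_notMem (hnotT a₀ ha₀)]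
  have hA4c : A.card = 4 := by
    rw [hA4, card_insert_of_notMem, card_insert_of_notMem, card_pair h23]
    · rw [mem_insert, mem_singleton, not_or]; exact ⟨h12, h13⟩
    · rw [mem_insert, mem_insert, mem_singleton, not_or, not_or]; exact ⟨h01, h02, h30.symm⟩
  have h2 := single_sub_thetaG_mem_or_of_orbit_corner c hc2 hcen T₀ T₁ hbase m hn hH Q hQ L hcover (by omega) T (A.erase a₀) hTH hTm
    ((erase_subset _ _).trans hA) (by rw [card_erase_of_mem ha₀, hA4c]; omega) _ hD₁
  have h1 := single_sub_thetaG_mem_or_of_orbit_corner c hc2 hcen T₀ T₁ hbase m hn hH Q hQ L hcover (by omega) T ((A.erase a₁).erase a₀)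
    hTH hTm ((erase_subset _ _).trans ((erase_subset _ _).trans hA))
    (by rw [card_erase_of_mem (mem_erase.mpr ⟨h01, ha₀⟩), card_erase_of_mem ha₁, hA4c]; omega) _ hD₂
  -- `(θ_{T₀} − θ_{T₁})(typeSum [Φ]) = R(T) + Y'(A)` and `Y'(A)` over the four places
  have hV := thetaG_sub_thetaG_orbit_type c hc2 T₀ T₁ m hH T A hTH hTm hA Φ hΦ
  have hsumA : ∑ a ∈ A, ((Finsupp.single (oflipCM c hc2 a T₀) (1 : ℤ) - Finsupp.single T₀ 1) - (Finsupp.single (oflipCM c hc2 a T₁) (1 : ℤ) - Finsupp.single T₁ 1)) =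
      ((Finsupp.single (oflipCM c hc2 a₀ T₀) (1 : ℤ) - Finsupp.single T₀ 1) - (Finsupp.single (oflipCM c hc2 a₀ T₁) (1 : ℤ) - Finsupp.single T₁ 1)) + ((Finsupp.single (oflipCM c hc2 a₁ T₀) (1 : ℤ) - Finsupp.single T₀ 1) - (Finsupp.single (oflipCM c hc2 a₁ T₁) (1 : ℤ) - Finsupp.single T₁ 1)) + ((Finsupp.single (oflipCM c hc2 a₂ T₀) (1 : ℤ) - Finsupp.single T₀ 1) - (Finsupp.single (oflipCM c hc2 a₂ T₁) (1 : ℤ) - Finsupp.single T₁ 1)) + ((Finsupp.single (oflipCM c hc2 a₃ T₀) (1 : ℤ) - Finsupp.single T₀ 1) - (Finsupp.single (oflipCM c hc2 a₃ T₁) (1 : ℤ) - Finsupp.single T₁ 1)) := by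
    rw [hA4, sum_insert, sum_insert, sum_pair h23]
    · abel
    · rw [mem_insert, mem_singleton, not_or]; exact ⟨h12, h13⟩
    · rw [mem_insert, mem_insert, mem_singleton, not_or, not_or]; exact ⟨h01, h02, h30.symm⟩
  rw [hsumA] at hV
  rcases h1 with h1 | h1 <;> rcases h2 with h2 | h2
  · -- directions `B₁ = T₀`, `B₂ = T₀`
    have t1_3 := transport Q _ _ h1; rw [c2_3, hQ] at t1_3
    have t1_2 := transport Q _ _ t1_3; rw [c2_2, hQ₁] at t1_2
    have t1_1 := transport Q _ _ t1_2; rw [c2_1, hQ] at t1_1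
    have t2_3 := transport Q _ _ h2; rw [c1_3, hQ] at t2_3
    have t2_2 := transport Q _ _ t2_3; rw [c1_2, hQ₁] at t2_2
    have t2_1 := transport Q _ _ t2_2; rw [c1_1, hQ] at t2_1
    have A0 := (orbit_face_relation_of_dirs c hc2 T₀ T₁ m hH Q hQ hQ₁ hσH L hLrt T A hTH hT hA hAσ Φ hΦ ha₃ ha₀ ha₁ r₃ r₀
      h01 h30 hF (Or.inl rfl) (Or.inl rfl) h1 h2 (by omega)).1 rfl
    have A3 := (orbit_face_relation_of_dirs c hc2 T₀ T₁ m hH Q hQ hQ₁ hσH L hLrt T A hTH hT hA hAσ Φ hΦ ha₂ ha₃ ha₀ r₂ r₃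
      h30 h23 hF₃ (Or.inr rfl) (Or.inr rfl) t1_3 t2_3 (by omega)).1 rfl
    have A2 := (orbit_face_relation_of_dirs c hc2 T₀ T₁ m hH Q hQ hQ₁ hσH L hLrt T A hTH hT hA hAσ Φ hΦ ha₁ ha₂ ha₃ r₁ r₂
      h23 h12 hF₂ (Or.inl rfl) (Or.inl rfl) t1_2 t2_2 (by omega)).1 rfl
    have A1 := (orbit_face_relation_of_dirs c hc2 T₀ T₁ m hH Q hQ hQ₁ hσH L hLrt T A hTH hT hA hAσ Φ hΦ ha₀ ha₁ ha₂ r₀ r₁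
      h12 h01 hF₁ (Or.inr rfl) (Or.inr rfl) t1_1 t2_1 (by omega)).1 rfl
    rw [hV] at A0 A3 A2 A1
    have B0 := Submodule.sub_mem _ A0 hR
    have B3 := Submodule.sub_mem _ A3 hR
    have B2 := Submodule.sub_mem _ A2 hR
    have B1 := Submodule.sub_mem _ A1 hR
    refine ⟨?_, ?_, ?_, ?_⟩
    · convert B2 using 1; abel
    · convert B3 using 1; abel
    · convert B0 using 1; abel
    · convert B1 using 1; abel
  · -- directions `B₁ = T₀`, `B₂ = T₁`
    have t1_3 := transport Q _ _ h1; rw [c2_3, hQ] at t1_3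
    have t1_2 := transport Q _ _ t1_3; rw [c2_2, hQ₁] at t1_2
    have t1_1 := transport Q _ _ t1_2; rw [c2_1, hQ] at t1_1
    have t2_3 := transport Q _ _ h2; rw [c1_3, hQ₁] at t2_3
    have t2_2 := transport Q _ _ t2_3; rw [c1_2, hQ] at t2_2
    have t2_1 := transport Q _ _ t2_2; rw [c1_1, hQ₁] at t2_1
    have A0 := (orbit_face_relation_of_dirs c hc2 T₀ T₁ m hH Q hQ hQ₁ hσH L hLrt T A hTH hT hA hAσ Φ hΦ ha₃ ha₀ ha₁ r₃ r₀
      h01 h30 hF (Or.inl rfl) (Or.inr rfl) h1 h2 (by omega)).2 hT₀₁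
    have A3 := (orbit_face_relation_of_dirs c hc2 T₀ T₁ m hH Q hQ hQ₁ hσH L hLrt T A hTH hT hA hAσ Φ hΦ ha₂ ha₃ ha₀ r₂ r₃
      h30 h23 hF₃ (Or.inr rfl) (Or.inl rfl) t1_3 t2_3 (by omega)).2 hT₀₁.symm
    have A2 := (orbit_face_relation_of_dirs c hc2 T₀ T₁ m hH Q hQ hQ₁ hσH L hLrt T A hTH hT hA hAσ Φ hΦ ha₁ ha₂ ha₃ r₁ r₂
      h23 h12 hF₂ (Or.inl rfl) (Or.inr rfl) t1_2 t2_2 (by omega)).2 hT₀₁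
    have A1 := (orbit_face_relation_of_dirs c hc2 T₀ T₁ m hH Q hQ hQ₁ hσH L hLrt T A hTH hT hA hAσ Φ hΦ ha₀ ha₁ ha₂ r₀ r₁
      h12 h01 hF₁ (Or.inr rfl) (Or.inl rfl) t1_1 t2_1 (by omega)).2 hT₀₁.symm
    rw [hV] at A0 A3 A2 A1
    have B0 := Submodule.sub_mem _ A0 hR
    have B3 := Submodule.sub_mem _ A3 hR
    have B2 := Submodule.sub_mem _ A2 hR
    have B1 := Submodule.sub_mem _ A1 hR
    refine ⟨?_, ?_, ?_, ?_⟩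
    · convert B3 using 1; abel
    · convert B0 using 1; abel
    · convert B1 using 1; abel
    · convert B2 using 1; abel
  · -- directions `B₁ = T₁`, `B₂ = T₀`
    have t1_3 := transport Q _ _ h1; rw [c2_3, hQ₁] at t1_3
    have t1_2 := transport Q _ _ t1_3; rw [c2_2, hQ] at t1_2
    have t1_1 := transport Q _ _ t1_2; rw [c2_1, hQ₁] at t1_1
    have t2_3 := transport Q _ _ h2; rw [c1_3, hQ] at t2_3
    have t2_2 := transport Q _ _ t2_3; rw [c1_2, hQ₁] at t2_2
    have t2_1 := transport Q _ _ t2_2; rw [c1_1, hQ] at t2_1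
    have A0 := (orbit_face_relation_of_dirs c hc2 T₀ T₁ m hH Q hQ hQ₁ hσH L hLrt T A hTH hT hA hAσ Φ hΦ ha₃ ha₀ ha₁ r₃ r₀
      h01 h30 hF (Or.inr rfl) (Or.inl rfl) h1 h2 (by omega)).2 hT₀₁.symm
    have A3 := (orbit_face_relation_of_dirs c hc2 T₀ T₁ m hH Q hQ hQ₁ hσH L hLrt T A hTH hT hA hAσ Φ hΦ ha₂ ha₃ ha₀ r₂ r₃
      h30 h23 hF₃ (Or.inl rfl) (Or.inr rfl) t1_3 t2_3 (by omega)).2 hT₀₁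
    have A2 := (orbit_face_relation_of_dirs c hc2 T₀ T₁ m hH Q hQ hQ₁ hσH L hLrt T A hTH hT hA hAσ Φ hΦ ha₁ ha₂ ha₃ r₁ r₂
      h23 h12 hF₂ (Or.inr rfl) (Or.inl rfl) t1_2 t2_2 (by omega)).2 hT₀₁.symm
    have A1 := (orbit_face_relation_of_dirs c hc2 T₀ T₁ m hH Q hQ hQ₁ hσH L hLrt T A hTH hT hA hAσ Φ hΦ ha₀ ha₁ ha₂ r₀ r₁
      h12 h01 hF₁ (Or.inl rfl) (Or.inr rfl) t1_1 t2_1 (by omega)).2 hT₀₁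
    rw [hV] at A0 A3 A2 A1
    have B0 := Submodule.sub_mem _ A0 hR
    have B3 := Submodule.sub_mem _ A3 hR
    have B2 := Submodule.sub_mem _ A2 hR
    have B1 := Submodule.sub_mem _ A1 hR
    refine ⟨?_, ?_, ?_, ?_⟩
    · convert B3 using 1; abel
    · convert B0 using 1; abel
    · convert B1 using 1; abel
    · convert B2 using 1; abel
  · -- directions `B₁ = T₁`, `B₂ = T₁`
    have t1_3 := transport Q _ _ h1; rw [c2_3, hQ₁] at t1_3
    have t1_2 := transport Q _ _ t1_3; rw [c2_2, hQ] at t1_2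
    have t1_1 := transport Q _ _ t1_2; rw [c2_1, hQ₁] at t1_1
    have t2_3 := transport Q _ _ h2; rw [c1_3, hQ₁] at t2_3
    have t2_2 := transport Q _ _ t2_3; rw [c1_2, hQ] at t2_2
    have t2_1 := transport Q _ _ t2_2; rw [c1_1, hQ₁] at t2_1
    have A0 := (orbit_face_relation_of_dirs c hc2 T₀ T₁ m hH Q hQ hQ₁ hσH L hLrt T A hTH hT hA hAσ Φ hΦ ha₃ ha₀ ha₁ r₃ r₀
      h01 h30 hF (Or.inr rfl) (Or.inr rfl) h1 h2 (by omega)).1 rfl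
    have A3 := (orbit_face_relation_of_dirs c hc2 T₀ T₁ m hH Q hQ hQ₁ hσH L hLrt T A hTH hT hA hAσ Φ hΦ ha₂ ha₃ ha₀ r₂ r₃
      h30 h23 hF₃ (Or.inl rfl) (Or.inl rfl) t1_3 t2_3 (by omega)).1 rfl
    have A2 := (orbit_face_relation_of_dirs c hc2 T₀ T₁ m hH Q hQ hQ₁ hσH L hLrt T A hTH hT hA hAσ Φ hΦ ha₁ ha₂ ha₃ r₁ r₂
      h23 h12 hF₂ (Or.inr rfl) (Or.inr rfl) t1_2 t2_2 (by omega)).1 rfl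
    have A1 := (orbit_face_relation_of_dirs c hc2 T₀ T₁ m hH Q hQ hQ₁ hσH L hLrt T A hTH hT hA hAσ Φ hΦ ha₀ ha₁ ha₂ r₀ r₁
      h12 h01 hF₁ (Or.inl rfl) (Or.inl rfl) t1_1 t2_1 (by omega)).1 rfl
    rw [hV] at A0 A3 A2 A1
    have B0 := Submodule.sub_mem _ A0 hR
    have B3 := Submodule.sub_mem _ A3 hR
    have B2 := Submodule.sub_mem _ A2 hR
    have B1 := Submodule.sub_mem _ A1 hR
    refine ⟨?_, ?_, ?_, ?_⟩
    · convert B2 using 1; abel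
    · convert B3 using 1; abel
    · convert B0 using 1; abel
    · convert B1 using 1; abel

/-! ## §2 The companion frame: consecutive `Y`-sums on a `σ'`-orbit of `𝓗` -/

include hcen hbase hn hH hLrt hcover in
/-- **CONSECUTIVE `Y`-SUMS ON AN ORBIT OF `𝓗`** — §1 in the companion frame `(T₀; T̄₁, c·Q')` of a base-involutive swap `Q'` (`T₀·Q'⁻¹ = T₁`,
`T₁·Q'⁻¹ = T₀`): `A' ⊆ T₀ ∩ T₁` a transversal of its place permutation (`|A'| = m ≥ 4`), `B = {b₀, b₁, b₂, b₃} ⊆ 𝓗` a `4`-cycle of it, `Ψ = {A' ∣ B}`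
(deviation set `A' ∪ B` from `T₀`); if the face of `Ψ` at the places `b₀, b₁` lies in `L ⊇ ℤ⟨pairs⟩`, then all four consecutive sums
`Y_{b_i} + Y_{b_{i+1}}` lie in `L` (`Y_s = (f_s − e₀) + (g_s − e₁)`; the pairs of the companion frame are absorbed). [folklore] -/
theorem orbit_consecutive_sums_companion (hP : ∀ Ψ : CMF G c, pair c Ψ ∈ L) (hm : 4 ≤ m) (Q' : G) (hQ' : rt c Q' T₀ = T₁) (hQ'₁ : rt c Q' T₁ = T₀)
    (hσH' : ∀ t ∈ T₀.1, ∀ t' ∈ T₀.1, (t' = t * Q' ∨ t' = c * (t * Q')) → (t ∈ T₀.1 \ T₁.1 ↔ t' ∈ T₀.1 \ T₁.1))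
    (A' B : Finset G) (hA'H : A' ⊆ T₀.1 ∩ T₁.1) (hA'm : A'.card = m)
    (hA't : ∀ t ∈ T₀.1 ∩ T₁.1, ∀ t' ∈ T₀.1, (t' = t * Q' ∨ t' = c * (t * Q')) → (t ∈ A' ↔ t' ∉ A'))
    (hB : B ⊆ T₀.1 \ T₁.1)
    (hBσ : ∀ t ∈ T₀.1 \ T₁.1, ∀ t' ∈ T₀.1, (t' = t * Q' ∨ t' = c * (t * Q')) → (t ∈ B ↔ t' ∈ B))
    (Ψ : CMF G c) (hΨ : T₀.1 \ Ψ.1 = A' ∪ B) {b₀ b₁ b₂ b₃ : G} (hb₀ : b₀ ∈ B) (hb₁ : b₁ ∈ B) (hb₂ : b₂ ∈ B) (hb₃ : b₃ ∈ B)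
    (r₀ : b₁ = b₀ * Q' ∨ b₁ = c * (b₀ * Q')) (r₁ : b₂ = b₁ * Q' ∨ b₂ = c * (b₁ * Q')) (r₂ : b₃ = b₂ * Q' ∨ b₃ = c * (b₂ * Q'))
    (r₃ : b₀ = b₃ * Q' ∨ b₀ = c * (b₃ * Q')) (h01 : b₀ ≠ b₁) (h12 : b₁ ≠ b₂) (h23 : b₂ ≠ b₃) (h30 : b₃ ≠ b₀) (h02 : b₀ ≠ b₂) (h13 : b₁ ≠ b₃)
    (hB4 : B = {b₀, b₁, b₂, b₃}) (hF : gface c hc2 Ψ b₀ b₁ ∈ L) :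
    ((Finsupp.single (oflipCM c hc2 b₀ T₀) (1 : ℤ) - Finsupp.single T₀ 1) + (Finsupp.single (oflipCM c hc2 b₀ T₁) (1 : ℤ) - Finsupp.single T₁ 1)) + ((Finsupp.single (oflipCM c hc2 b₁ T₀) (1 : ℤ) - Finsupp.single T₀ 1) + (Finsupp.single (oflipCM c hc2 b₁ T₁) (1 : ℤ) - Finsupp.single T₁ 1)) ∈ L ∧
    ((Finsupp.single (oflipCM c hc2 b₁ T₀) (1 : ℤ) - Finsupp.single T₀ 1) + (Finsupp.single (oflipCM c hc2 b₁ T₁) (1 : ℤ) - Finsupp.single T₁ 1)) + ((Finsupp.single (oflipCM c hc2 b₂ T₀) (1 : ℤ) - Finsupp.single T₀ 1) + (Finsupp.single (oflipCM c hc2 b₂ T₁) (1 : ℤ) - Finsupp.single T₁ 1)) ∈ L ∧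
    ((Finsupp.single (oflipCM c hc2 b₂ T₀) (1 : ℤ) - Finsupp.single T₀ 1) + (Finsupp.single (oflipCM c hc2 b₂ T₁) (1 : ℤ) - Finsupp.single T₁ 1)) + ((Finsupp.single (oflipCM c hc2 b₃ T₀) (1 : ℤ) - Finsupp.single T₀ 1) + (Finsupp.single (oflipCM c hc2 b₃ T₁) (1 : ℤ) - Finsupp.single T₁ 1)) ∈ L ∧
    ((Finsupp.single (oflipCM c hc2 b₃ T₀) (1 : ℤ) - Finsupp.single T₀ 1) + (Finsupp.single (oflipCM c hc2 b₃ T₁) (1 : ℤ) - Finsupp.single T₁ 1)) + ((Finsupp.single (oflipCM c hc2 b₀ T₀) (1 : ℤ) - Finsupp.single T₀ 1) + (Finsupp.single (oflipCM c hc2 b₀ T₁) (1 : ℤ) - Finsupp.single T₁ 1)) ∈ L := by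
  have hHc : T₀.1 \ (rt c c T₁).1 = T₀.1 ∩ T₁.1 := by
    rw [dev_compl c hcen T₀ T₁]; ext t; simp only [mem_sdiff, mem_inter, not_and, not_not]; tauto
  have hHc' : T₀.1 \ (T₀.1 \ (rt c c T₁).1) = T₀.1 \ T₁.1 := by
    rw [hHc]; ext t; simp only [mem_sdiff, mem_inter, not_and]; tauto
  have hA't' : ∀ t ∈ T₀.1 \ (rt c c T₁).1, ∀ t' ∈ T₀.1, (t' = t * (c * Q') ∨ t' = c * (t * (c * Q'))) → (t ∈ A' ↔ t' ∉ A') := by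
    intro t ht t' ht' h
    rw [or_companion_iff c hc2 hcen Q'] at h
    rw [hHc] at ht
    exact hA't t ht t' ht' h
  have hBσ' : ∀ t ∈ T₀.1 \ (T₀.1 \ (rt c c T₁).1), ∀ t' ∈ T₀.1, (t' = t * (c * Q') ∨ t' = c * (t * (c * Q'))) → (t ∈ B ↔ t' ∈ B) := by
    intro t ht t' ht' h
    rw [or_companion_iff c hc2 hcen Q'] at h
    rw [hHc'] at ht
    exact hBσ t ht t' ht' h
  -- the companion transversal relation `R(A')` (part XXV in the companion frame)
  have hR := rel_transversal_mem' c hc2 hcen T₀ (rt c c T₁) (companion_base c hc2 T₀ T₁ hbase) m hn (companion_card c hcen T₀ T₁ m hn hH)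
    (c * Q') (companion_rt c T₀ T₁ Q' hQ') (companion_rt₁ c hc2 hcen T₀ T₁ Q' hQ'₁) (companion_swap c hc2 hcen T₀ T₁ Q' hσH') L hLrt hcover
    A' (by rw [hHc]; exact hA'H) hA'm hA't' (by omega)
  have main := orbit_consecutive_sums c hc2 hcen T₀ (rt c c T₁) (companion_base c hc2 T₀ T₁ hbase) m hn (companion_card c hcen T₀ T₁ m hn hH)
    (c * Q') (companion_rt c T₀ T₁ Q' hQ') (companion_rt₁ c hc2 hcen T₀ T₁ Q' hQ'₁) (companion_swap c hc2 hcen T₀ T₁ Q' hσH') L hLrt hcover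
    hm A' B (by rw [hHc]; exact hA'H) hA'm hA't' (by rw [hHc']; exact hB) hBσ' Ψ hΨ hb₀ hb₁ hb₂ hb₃
    ((or_companion_iff c hc2 hcen Q' b₀ b₁).mpr r₀) ((or_companion_iff c hc2 hcen Q' b₁ b₂).mpr r₁)
    ((or_companion_iff c hc2 hcen Q' b₂ b₃).mpr r₂) ((or_companion_iff c hc2 hcen Q' b₃ b₀).mpr r₃) h01 h12 h23 h30 h02 h13 hB4 hF hR
  have hsr : ∀ X : CMF G c, Finsupp.single (rt c c X) (1 : ℤ) = pair c X - Finsupp.single X 1 := fun X => by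
    rw [pair, add_sub_cancel_left]
  simp only [oflipCM_rt_self c hc2 hcen, hsr] at main
  obtain ⟨m01, m12, m23, m30⟩ := main
  have fix : ∀ x y : G,
      ((Finsupp.single (oflipCM c hc2 x T₀) (1 : ℤ) - Finsupp.single T₀ 1) -
          ((pair c (oflipCM c hc2 x T₁) - Finsupp.single (oflipCM c hc2 x T₁) (1 : ℤ)) - (pair c T₁ - Finsupp.single T₁ 1))) +
        ((Finsupp.single (oflipCM c hc2 y T₀) (1 : ℤ) - Finsupp.single T₀ 1) -
          ((pair c (oflipCM c hc2 y T₁) - Finsupp.single (oflipCM c hc2 y T₁) (1 : ℤ)) - (pair c T₁ - Finsupp.single T₁ 1))) ∈ L →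
      ((Finsupp.single (oflipCM c hc2 x T₀) (1 : ℤ) - Finsupp.single T₀ 1) + (Finsupp.single (oflipCM c hc2 x T₁) (1 : ℤ) - Finsupp.single T₁ 1)) + ((Finsupp.single (oflipCM c hc2 y T₀) (1 : ℤ) - Finsupp.single T₀ 1) + (Finsupp.single (oflipCM c hc2 y T₁) (1 : ℤ) - Finsupp.single T₁ 1)) ∈ L := by
    intro x y h
    have h' := Submodule.add_mem _ (Submodule.add_mem _ h (Submodule.sub_mem _ (hP (oflipCM c hc2 x T₁)) (hP T₁)))
      (Submodule.sub_mem _ (hP (oflipCM c hc2 y T₁)) (hP T₁))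
    convert h' using 1; abel
  exact ⟨fix _ _ m01, fix _ _ m12, fix _ _ m23, fix _ _ m30⟩

/-! ## §3 Residual closure up to `4` from the consecutive sums -/

include hcen hbase hn hH hQ hQ₁ hσH hLrt hcover in
/-- **RESIDUAL CLOSURE UP TO `4` (ORBIT FRAME LAW, closure form).**  `G` with a central involution `c ≠ 1`; base-involutive frame `(T₀; T₁, Q)`
(`|T₀| = 4m`, `|𝓗| = 2m`) with a strict lowering cover behind the base-change stable lattice `L ⊇ ℤ⟨pairs⟩`; a second base-involutive swap
`Q'`; transversals of `Q` in `T₀ ∩ T₁` and of `Q'` in `𝓗` exist.  If every place `k ∈ T₀ ∩ T₁` lies on a `4`-cycle of the place permutation of `Q`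
inside `T₀ ∩ T₁` whose three consecutive `Y'`-sums from `k` lie in `L`, and every place `h ∈ 𝓗` lies on a `4`-cycle of the place permutation of
`Q'` inside `𝓗` whose three consecutive `Y`-sums from `h` lie in `L`, then `4y ∈ L` for every Hodge vector `y` supported on types of potential `≤ 1`.
[folklore] -/
theorem residual_closure_orbit_four (hc1 : c ≠ 1) (hP : ∀ Ψ : CMF G c, pair c Ψ ∈ L) (hm : 2 ≤ m)
    (Q' : G) (hQ' : rt c Q' T₀ = T₁) (hQ'₁ : rt c Q' T₁ = T₀)
    (hσH' : ∀ t ∈ T₀.1, ∀ t' ∈ T₀.1, (t' = t * Q' ∨ t' = c * (t * Q')) → (t ∈ T₀.1 \ T₁.1 ↔ t' ∈ T₀.1 \ T₁.1))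
    (hT : ∃ T : Finset G, T ⊆ T₀.1 \ T₁.1 ∧ T.card = m ∧
      ∀ t ∈ T₀.1 \ T₁.1, ∀ t' ∈ T₀.1, (t' = t * Q' ∨ t' = c * (t * Q')) → (t ∈ T ↔ t' ∉ T))
    (hT' : ∃ T' : Finset G, T' ⊆ T₀.1 ∩ T₁.1 ∧ T'.card = m ∧
      ∀ t ∈ T₀.1 ∩ T₁.1, ∀ t' ∈ T₀.1, (t' = t * Q ∨ t' = c * (t * Q)) → (t ∈ T' ↔ t' ∉ T'))
    (hcycH : ∀ h₀ ∈ T₀.1 \ T₁.1, ∃ h₁ h₂ h₃ : G, h₁ ∈ T₀.1 \ T₁.1 ∧ h₂ ∈ T₀.1 \ T₁.1 ∧ h₃ ∈ T₀.1 \ T₁.1 ∧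
      (h₁ = h₀ * Q' ∨ h₁ = c * (h₀ * Q')) ∧ (h₂ = h₁ * Q' ∨ h₂ = c * (h₁ * Q')) ∧ (h₃ = h₂ * Q' ∨ h₃ = c * (h₂ * Q')) ∧
      (h₀ = h₃ * Q' ∨ h₀ = c * (h₃ * Q')) ∧ h₀ ≠ h₂ ∧ h₁ ≠ h₃ ∧
      ((Finsupp.single (oflipCM c hc2 h₀ T₀) (1 : ℤ) - Finsupp.single T₀ 1) + (Finsupp.single (oflipCM c hc2 h₀ T₁) (1 : ℤ) - Finsupp.single T₁ 1)) + ((Finsupp.single (oflipCM c hc2 h₁ T₀) (1 : ℤ) - Finsupp.single T₀ 1) + (Finsupp.single (oflipCM c hc2 h₁ T₁) (1 : ℤ) - Finsupp.single T₁ 1)) ∈ L ∧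
      ((Finsupp.single (oflipCM c hc2 h₁ T₀) (1 : ℤ) - Finsupp.single T₀ 1) + (Finsupp.single (oflipCM c hc2 h₁ T₁) (1 : ℤ) - Finsupp.single T₁ 1)) + ((Finsupp.single (oflipCM c hc2 h₂ T₀) (1 : ℤ) - Finsupp.single T₀ 1) + (Finsupp.single (oflipCM c hc2 h₂ T₁) (1 : ℤ) - Finsupp.single T₁ 1)) ∈ L ∧
      ((Finsupp.single (oflipCM c hc2 h₂ T₀) (1 : ℤ) - Finsupp.single T₀ 1) + (Finsupp.single (oflipCM c hc2 h₂ T₁) (1 : ℤ) - Finsupp.single T₁ 1)) + ((Finsupp.single (oflipCM c hc2 h₃ T₀) (1 : ℤ) - Finsupp.single T₀ 1) + (Finsupp.single (oflipCM c hc2 h₃ T₁) (1 : ℤ) - Finsupp.single T₁ 1)) ∈ L)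
    (hcycC : ∀ k₀ ∈ T₀.1 ∩ T₁.1, ∃ k₁ k₂ k₃ : G, k₁ ∈ T₀.1 ∩ T₁.1 ∧ k₂ ∈ T₀.1 ∩ T₁.1 ∧ k₃ ∈ T₀.1 ∩ T₁.1 ∧
      (k₁ = k₀ * Q ∨ k₁ = c * (k₀ * Q)) ∧ (k₂ = k₁ * Q ∨ k₂ = c * (k₁ * Q)) ∧ (k₃ = k₂ * Q ∨ k₃ = c * (k₂ * Q)) ∧
      (k₀ = k₃ * Q ∨ k₀ = c * (k₃ * Q)) ∧ k₀ ≠ k₂ ∧ k₁ ≠ k₃ ∧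
      ((Finsupp.single (oflipCM c hc2 k₀ T₀) (1 : ℤ) - Finsupp.single T₀ 1) - (Finsupp.single (oflipCM c hc2 k₀ T₁) (1 : ℤ) - Finsupp.single T₁ 1)) + ((Finsupp.single (oflipCM c hc2 k₁ T₀) (1 : ℤ) - Finsupp.single T₀ 1) - (Finsupp.single (oflipCM c hc2 k₁ T₁) (1 : ℤ) - Finsupp.single T₁ 1)) ∈ L ∧
      ((Finsupp.single (oflipCM c hc2 k₁ T₀) (1 : ℤ) - Finsupp.single T₀ 1) - (Finsupp.single (oflipCM c hc2 k₁ T₁) (1 : ℤ) - Finsupp.single T₁ 1)) + ((Finsupp.single (oflipCM c hc2 k₂ T₀) (1 : ℤ) - Finsupp.single T₀ 1) - (Finsupp.single (oflipCM c hc2 k₂ T₁) (1 : ℤ) - Finsupp.single T₁ 1)) ∈ L ∧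
      ((Finsupp.single (oflipCM c hc2 k₂ T₀) (1 : ℤ) - Finsupp.single T₀ 1) - (Finsupp.single (oflipCM c hc2 k₂ T₁) (1 : ℤ) - Finsupp.single T₁ 1)) + ((Finsupp.single (oflipCM c hc2 k₃ T₀) (1 : ℤ) - Finsupp.single T₀ 1) - (Finsupp.single (oflipCM c hc2 k₃ T₁) (1 : ℤ) - Finsupp.single T₁ 1)) ∈ L) :
    ∀ y ∈ hodgeSpan c hc2, (∀ Ψ ∈ y.support, bpot c T₀ Ψ ≤ 1) → ((2 : ℤ) ^ 2) • y ∈ L := by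
  have hHc : (T₀.1 ∩ T₁.1).card = 2 * m := by
    have h0 := card_sdiff_add_card_inter T₀.1 T₁.1; omega
  have hRall : ∀ T : Finset G, T ⊆ T₀.1 \ T₁.1 → T.card = m →
      (∀ t ∈ T₀.1 \ T₁.1, ∀ t' ∈ T₀.1, (t' = t * Q' ∨ t' = c * (t * Q')) → (t ∈ T ↔ t' ∉ T)) →
      (∑ s ∈ T, Finsupp.single (oflipCM c hc2 s T₀) (1 : ℤ) - ∑ u ∈ (T₀.1 \ T₁.1) \ T, Finsupp.single (oflipCM c hc2 u T₁) (1 : ℤ) -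
        ((m : ℤ) - 1) • (Finsupp.single T₀ (1 : ℤ) - Finsupp.single T₁ 1)) ∈ L :=
    fun T hTH hTm hTt => rel_transversal_mem' c hc2 hcen T₀ T₁ hbase m hn hH Q' hQ' hQ'₁ hσH' L hLrt hcover T hTH hTm hTt hm
  have hRcall : ∀ T' : Finset G, T' ⊆ T₀.1 ∩ T₁.1 → T'.card = m →
      (∀ t ∈ T₀.1 ∩ T₁.1, ∀ t' ∈ T₀.1, (t' = t * Q ∨ t' = c * (t * Q)) → (t ∈ T' ↔ t' ∉ T')) →
      (∑ s ∈ T', Finsupp.single (oflipCM c hc2 s T₀) (1 : ℤ) + ∑ u ∈ (T₀.1 ∩ T₁.1) \ T', Finsupp.single (oflipCM c hc2 u T₁) (1 : ℤ) -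
        ((m : ℤ) - 1) • (Finsupp.single T₀ (1 : ℤ) + Finsupp.single T₁ 1)) ∈ L :=
    fun T' hTH hTm hTt => relc_mem' c hc2 hcen T₀ T₁ hbase m hn hH Q hQ hQ₁ hσH L hLrt hcover T' hTH hTm hTt hP hm
  have h4Y : ∀ s ∈ T₀.1 \ T₁.1, (4 : ℤ) • ((Finsupp.single (oflipCM c hc2 s T₀) (1 : ℤ) - Finsupp.single T₀ 1) + (Finsupp.single (oflipCM c hc2 s T₁) (1 : ℤ) - Finsupp.single T₁ 1)) ∈ L := by
    intro s hs
    obtain ⟨h₁, h₂, h₃, hh₁, hh₂, hh₃, r₀, r₁, r₂, r₃, h02, h13, p01, p12, p23⟩ := hcycH s hs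
    exact four_smul_Y_mem_of_cycle c hc2 T₀ T₁ m Q' L hRall hT hs hh₁ hh₂ hh₃ r₀ r₁ r₂ r₃ h02 h13 p01 p12 p23
  have h4Y' : ∀ s ∈ T₀.1 ∩ T₁.1, (4 : ℤ) • ((Finsupp.single (oflipCM c hc2 s T₀) (1 : ℤ) - Finsupp.single T₀ 1) - (Finsupp.single (oflipCM c hc2 s T₁) (1 : ℤ) - Finsupp.single T₁ 1)) ∈ L := by
    intro s hs
    obtain ⟨k₁, k₂, k₃, hk₁, hk₂, hk₃, r₀, r₁, r₂, r₃, h02, h13, p01, p12, p23⟩ := hcycC s hs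
    exact four_smul_Y'_mem_of_cycle c hc2 T₀ T₁ m Q L hRcall hT' hs hk₁ hk₂ hk₃ r₀ r₁ r₂ r₃ h02 h13 p01 p12 p23
  obtain ⟨T, hTH, hTm, hTt⟩ := hT
  obtain ⟨T', hTH', hTm', hTt'⟩ := hT'
  exact residual_closure_frame_four c hc2 hc1 hcen T₀ T₁ hbase L hP m hH hHc h4Y h4Y' ⟨T, hTH, hTm, hRall T hTH hTm hTt⟩
    ⟨T', hTH', hTm', hRcall T' hTH' hTm' hTt'⟩

end Frame

end

end Summit.HodgeConjecture.CorCM.Census.CentralSquares
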